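import Literature.Topology.FourManifolds.SeifertDiscUnknot
import Literature.Topology.FourManifolds.KnotsProofs
import HarnessLib

/-!
# `g(K) = 0 ↔ K` is the unknot: the named fact is equivalent to Seifert's theorem together with
# "a knot bounding a disc is trivial"

Sibling proof file of `Literature/Topology/FourManifolds/SliceGenus.lean` (fact seat
`provefact-Literature.Topology.FourManifolds.Knot.genus_eq_zero_iff_isUnknot`), for its named fact
`Literature.Topology.FourManifolds.Knot.genus_eq_zero_iff_isUnknot`
(`∀ K, K.genus = 0 ↔ K.IsUnknot`; Cromwell, *Knots and Links* (2004), Ch. 5, p. 103 — held copy,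
PDF p. 79: "Any knot with genus zero is spanned by a disc and hence is the trivial knot",
together with Thm. 5.1.1, Seifert's algorithm, which makes the genus well defined; Rolfsen,
*Knots and Links* (1976), §5.A).  Everything here is **proved**; no definitions, no named facts.

`SeifertGenusZero.lean` proves the direction `←` (`Knot.IsUnknot.genus_eq_zero`) and reduces the
fact to Seifert's theorem `Knot.exists_hasSeifertSurfaceOfGenus` (`hS`, needed because
`Knot.genus` is an `sInf` with junk value `0` on the empty set) and "a knot bounding a disc is
trivial" `Knot.isUnknot_of_hasSeifertSurfaceOfGenus_zero` (`hD`):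
`Knot.genus_eq_zero_iff_isUnknot_of hS hD`.  `SeifertDiscUnknot.lean` proves the converse bridge
for `hD` (`Knot.isUnknot_of_hasSeifertSurfaceOfGenus_zero_of_genus_eq_zero_iff`).  This file closes
the square:

* `Knot.exists_hasSeifertSurfaceOfGenus_of_genus_eq_zero_iff_isUnknot` — **the fact implies
  Seifert's theorem**: if `K` had no Seifert surface at all, `K.genus = sInf ∅ = 0`, so `K` would
  be unknotted by the fact, and an unknotted knot bounds a disc
  (`Knot.IsUnknot.hasSeifertSurfaceOfGenus_zero`), a contradiction;
* `Knot.genus_eq_zero_iff_isUnknot_iff` — hence **the fact is equivalent to `hS ∧ hD`**: it is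
  exactly as strong as Seifert's theorem together with Cromwell's sentence, and cannot be
  discharged before either (both are open named facts of the tree; their current open leaves are
  the circle-map fact `Knot.exists_circleMap_eq_angle_of_hasFraming_zero` and the parity fact
  `even_finrank_singularHomology_one_of_boundary_circle` under `hS`
  (`Knot.exists_hasSeifertSurfaceOfGenus_of_facts`, `SeifertSurfaceOrientation.lean`, Sard being
  discharged), and Milnor's chart `Cobordism.Milnor1965_cancellation_modelChart` with the disc
  theorem `exists_ambientIsotopy_of_smoothDisc_sphereThree` under `hD`
  (`Knot.isUnknot_of_hasSeifertSurfaceOfGenus_zero_of`, `SeifertDiscUnknot.lean`, with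
  `diffeomorph_closedBall_of_genus_zero_of_facts`, `SliceGenusDiscMorse.lean`)).

The assembly of the fact from those four leaves is kept out of this file on purpose (its import
closure is the whole Morse-theoretic part of the topic); it lives in the sibling
`SliceGenusUnknotLeaves.lean`.

## References

* P. R. Cromwell, *Knots and Links*, CUP (2004), Ch. 5, p. 103 (held copy, PDF p. 79) and
  Thm. 5.1.1. [Cromwell2004]
* D. Rolfsen, *Knots and Links* (1976), Ch. 5 §A. [RolfsenKnotsLinks1976]
* C. D. Papakyriakopoulos, *On Dehn's lemma and the asphericity of knots*, Ann. of Math. 66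
  (1957) (the cite carried by the fact). [Papakyriakopoulos1957]
-/

open scoped Manifold ContDiff Topology
open Function Set

noncomputable section

namespace Literature.Topology.FourManifolds

namespace Knot

/-! ### The fact is equivalent to Seifert's theorem together with "a disc-bounding knot is trivial" -/

/-- **The bundled fact `Knot.genus_eq_zero_iff_isUnknot` implies Seifert's theorem**
`Knot.exists_hasSeifertSurfaceOfGenus` (every knot bounds a Seifert surface of some genus): if
`K` bounded no Seifert surface at all, then `K.genus = sInf ∅ = 0` (junk value of `Nat.sInf`), so
`K` is unknotted by the fact, and an unknotted knot bounds a smoothly embedded disc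
(`Knot.IsUnknot.hasSeifertSurfaceOfGenus_zero`, `SeifertGenusZero.lean`) — a Seifert surface of
genus `0`, contradiction.  (The instance `[SphereEmbedding.SmoothnessFacts]` under which the fact
is stated is the tree's `SphereEmbedding.smoothnessFacts`, `KnotsProofs.lean`.)  Cromwell (2004),
Ch. 5, p. 103 with Thm. 5.1.1 ("First we establish that link genus is well-defined").
[cite: Cromwell2004, Ch. 5 p. 103 and Thm. 5.1.1] -/
theorem exists_hasSeifertSurfaceOfGenus_of_genus_eq_zero_iff_isUnknot
    (h : genus_eq_zero_iff_isUnknot) : exists_hasSeifertSurfaceOfGenus := by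
  intro K
  by_contra hK
  have hempty : {g | K.HasSeifertSurfaceOfGenus g} = ∅ :=
    Set.ext fun g ↦ ⟨fun hg ↦ hK ⟨g, hg⟩, fun hg ↦ hg.elim⟩
  have h0 : K.genus = 0 := by
    rw [genus, hempty, Nat.sInf_empty]
  exact hK ⟨0, ((h K).1 h0).hasSeifertSurfaceOfGenus_zero⟩

/-- **`Knot.genus_eq_zero_iff_isUnknot` is equivalent to the conjunction of Seifert's theorem
`Knot.exists_hasSeifertSurfaceOfGenus` and "a knot bounding a disc is the trivial knot"
`Knot.isUnknot_of_hasSeifertSurfaceOfGenus_zero`**: `→` by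
`exists_hasSeifertSurfaceOfGenus_of_genus_eq_zero_iff_isUnknot` and
`isUnknot_of_hasSeifertSurfaceOfGenus_zero_of_genus_eq_zero_iff` (`SeifertDiscUnknot.lean`), `←` by
`genus_eq_zero_iff_isUnknot_of` (`SeifertGenusZero.lean`).  Cromwell (2004), Ch. 5, p. 103: "Any
knot with genus zero is spanned by a disc and hence is the trivial knot", after Thm. 5.1.1
(Seifert's algorithm).  [cite: Cromwell2004, Ch. 5 p. 103 and Thm. 5.1.1] -/
theorem genus_eq_zero_iff_isUnknot_iff :
    genus_eq_zero_iff_isUnknot ↔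
      exists_hasSeifertSurfaceOfGenus ∧ isUnknot_of_hasSeifertSurfaceOfGenus_zero :=
  ⟨fun h ↦ ⟨exists_hasSeifertSurfaceOfGenus_of_genus_eq_zero_iff_isUnknot h,
      isUnknot_of_hasSeifertSurfaceOfGenus_zero_of_genus_eq_zero_iff h⟩,
    fun h ↦ genus_eq_zero_iff_isUnknot_of h.1 h.2⟩

end Knot

end Literature.Topology.FourManifolds
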